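/-
Copyright (c) 2026 the pub-hodgecm-mathlib formalisation cell (harness21).  R90-TF SLAB, section S10 (Rogawski 1990, Ch. 13.5–13.8 comparison engine read at `v`),
typist R90-C138-typ2 (g2) typing FILE F at HOME; h413 = `stmt-HodgeConjecture-24833`, route `HCCMUnconditional`.
-/
import Summits.HodgeConjecture.HodgeConjecture.Cruxes.H413.Lines.R90_S5_GOfRecordC2        -- S5-C2 (tree e31d87361b34, BUILT K5): `R90.S5.gOfRecord` + `rfl` read-backs, `gOfRecord_packetTrichotomy`, `not_isThetaFin_of_isOneDimH`
import Summits.HodgeConjecture.HodgeConjecture.Theorems.R90S10GermOfDiscreteClass           -- ★ p862155 `R90.S10.germOfDiscreteClass` (`t(c)` at level `S`) + read-back `germOfDiscreteClass_mk`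
import Summits.HodgeConjecture.HodgeConjecture.Theorems.R90S10UnrHatPinsOfRestricted        -- ★ p862102 `R90.S10.unrHatPins_of_restricted` (the five `hat`-pins over bounded star-fixed e.v.p.'s)
import Summits.HodgeConjecture.HodgeConjecture.Theorems.R90S5APacketMultOfCoreLaws          -- ★ `R90.S5.aPacketMult_of_coreLaws_of_pins` (Thm 13.3.7 for `Π(ξ)`), `nComponent_routesToAPacket_of_coreLaws` (13.3.6 (c))
import Literature.NumberTheory.Rogawski1990.TwistedComparisonSpectralSide                   -- ★ `TwistedComparisonData` (the 37-field dictionary datum), its laws, `separation_of_pins`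
import Literature.NumberTheory.Rogawski1990.APacketEigenvalueGerm                           -- ★ `GlobalPacketData.OneDimNotTheta` (Prop. 11.1.1 (a) as a relation)
import Summits.HodgeConjecture.HodgeConjecture.Theorems.R90S5FinTriggerMembershipOfCoreLawsAndPins   -- ★ S5 consumer `R90.S5.finTriggerMembershipAt_of_coreLaws_of_pins` (QS-T, named pins) — used ONLY by the closing cert `example` (§5; +3 modules)
import HarnessLib

/-!
# R90-TF ∕ S10 — FILE F: THE HONEST TWISTED-COMPARISON DATUM `𝔨` OF RECORD for S5 (`Cruxes/H413/Lines/R90_S10_TwistedDatumF.lean`;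
# ns `Summit.HodgeConjecture.HodgeConjecture.R90.S10`; ONE parameter structure + ONE builder + PROVED pin-laws and read-backs — NO socket, NO stub)

Cell `hodgecm-mathlib`, crux H413 (`stmt-HodgeConjecture-24833`), route of record `HCCMUnconditional`; programme R90-TF, section S10 (base `R90-C138`,
Rogawski Ch. 13.5–13.8), junction J-S5→S10 «the honest `𝔨`» (LEAD #16 (A3), S5 J3-R1…R6, HEADS-D.v3 §K∕§K.1 c1512d410958783d, HEADS-D.v4 §F-delta 6e676a678b4dae3a).
Typist R90-C138-typ2 (g2).  ED. 1.

WHAT THIS FILE IS.  S5's pay editions (`finTriggerMembershipAt_of_coreLaws_of_pins`, ★ `R90S5FinTriggerMembershipOfCoreLawsAndPins`; D ED. 4) quantify over a ★ dictionary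
datum `𝔨 : TwistedComparisonData TGt (TestG L) (TestH L)` [§13.5–13.7] and PIN it to the S5 objects of record by named `rfl`∕law binders.  This file BUILDS that `𝔨`:
* `𝔨.𝔊 := R90.S5.gOfRecord 𝔩 𝔞 𝔞H μ μ₂ μ₁ archH Pk μω pairG` — S5-C2's `𝔊` of record, DEFINITIONALLY (`twistedDatumOfRecord_G`, `rfl`);
* the e.v.p. currency of E1 at level `S` [§13.6 p. 209]: `𝔨.Germ := GermSub S bd σ` = the BOUNDED, STAR-FIXED eigenvalue packages `t = {t_v}_{v ∉ S}` of the unramified Hecke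
  algebras `𝓗_v = 𝓗(U(Φ₃)(F_v), K_v)` (★ `heckeAlgebra`, E1's `evpAtIntegralLevel` target), `𝔨.Unr := UnrSub S` = restricted pure tensors `⊗_{v∉S} f_v` (`f_v = 1` a.a.),
  `𝔨.hat t f := ∏ᶠ_v t_v(f_v)` (★ `Ch13Sec6.EigenvaluePackage.hat`), `𝔨.germRep c := t(c)` (★ p862155 `germOfDiscreteClass S c`), and the §14.6 inner-form socket READ AT THE
  QUASI-SPLIT FORM ITSELF: `𝔨.RepGp := DiscreteClass (U(Φ₃)) μ`, `𝔨.mGp c := c.mult.toNat` (= `𝔨.𝔊.m c`, `rfl`), `𝔨.germGp := 𝔨.germRep` (S5's pin `hPin_germGp := rfl` at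
  `clsGp := cls`);
* `𝔨.IsOneDimH := R90.S5.IsOneDimH` (★ p862138: «`ρ` is the packet of a one-dimensional automorphic `ξ`», kit-law-free);
* EVERY OTHER SECTION — the twisted side `G̃ = Res_{E/F} GL₃ ⋊ ε` (test spaces `TGtS, TGS, THS`, tensors, matchings `φ → f`, `φ → φ^H`, `MatchS`, the traces `trS, trEpsS, trIS,
  trHS, trIμS`, `Π_ε(G̃)` = `RepGt` with `IsCuspidalGt, germGt`, the regular characters `ThetaReg, germTheta, rhoTheta`, the sign `alpha`, the distributions `θ_G̃, SΘ_G, SΘ_H`,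
  the germ coefficient `coeff`, `germPacket`, `HasNComponent`) — is a FIELD of ONE parameter structure `TwistedSections …` (HEADS-D.v4 F2: under Q-S1 S8-A's carpet is ASIDE
  on path, so F owns none of these; the twisted-trace-formula owner instantiates them, junction J-F-2), together with the one proof obligation `hRepGerm` «`t(c)` is bounded
  by `bd` and `σ`-star-fixed» (E1: unitarity of discrete classes ⇒ `|t_v(f)| ≤ ‖f‖₁`, `t_v(f*) = conj (t_v f)`; paid by the instantiator from E1 currency).
WHAT IS PROVED HERE (no stub): the three PIN-LAWS `HatInjective`, `HatBounded`, `UnrStarAlgebra` of `𝔨` (★ p862102 `unrHatPins_of_restricted`, under `hσ : σ_v 1 = 1`), hence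
`Separation` [§13.7 «separating by Hecke eigenvalues», ★ `separation_of_pins`]; `𝔨.𝔊.PacketTrichotomy` [Thm. 13.3.5] (C2 ★ `gOfRecord_packetTrichotomy`); the relation
`𝔨.𝔊.OneDimNotTheta 𝔨.IsOneDimH` [Prop. 11.1.1 (a): a one-dimensional `ξ` is not `ρ(θ)`] (C2 ★ `not_isThetaFin_of_isOneDimH`, under `μω` unitary + (ℓ8) + cofinite
unramifiedness); the `rfl` read-backs S5 pins by `rfl`; and the two HEADS at the record — Thm. 13.3.7 for `Π(ξ)` (`aPacketMult_of_record`, ★ `aPacketMult_of_coreLaws_of_pins`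
with the three pins and `hnt` DISCHARGED) and Thm. 13.3.6 (c) e.v.p. routing (`nComponent_routesToAPacket_of_record`, ★ `nComponent_routesToAPacket_of_coreLaws` with the
trichotomy DISCHARGED); and the closing cert `example` (§5): S5's ★ consumer `finTriggerMembershipAt_of_coreLaws_of_pins` instantiated at `𝔨 := twistedDatumOfRecord …` with
`hS`∕`hTri`∕`h1` discharged and the pins `clsGp := cls`, `hPin_mGp := hPin_m`, `hPin_germGp := rfl` accepted.  The SIX analytic core laws (`MainEquality` [Thm. 10.3.1 (a)], `MatchTensor` [§4.5, 4.9–4.13], `GermExpansion` [Props. 13.5.1, 13.6.1–2],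
`CoeffEndoscopic` [§13.7 (3) + Lemma 13.6.3], `APacketLift` [Prop. 13.2.2 (d)], `LinIndepGerm` [Prop. 13.8.1]) and the four routing laws (`PacketGerm`, `EvpDichotomyGp`,
`StableExclusionGp`, `EndoscopicExclusionGp` [§14.6]) stay NAMED HYPOTHESES of the heads, exactly as in ★ `aPacketMult_of_coreLaws_of_pins` — their payers are the S10 files
D∕B∕A (13.8 at `v`) and S5∕S7; this file claims none of them.
C5 NOTE (R90-C14-audit1 tree box S5-C2, 22:04:11Z): `𝔨.𝔊.m c = c.mult.toNat` is junk `0` at `mult = ⊤`; this file equates `m` with nothing — a consumer reading `m` as print's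
multiplicity names the admissibility (finiteness) fact itself.
ED. 2 (typ2 (g3), ADDITIONS ONLY — S10 dealer R90-C138-plan (g2) DEAL #2 (g2) (B) (O1) GO 23:11:40Z; S5 RULING S5-R5 «ROAD 0» 23:00:23Z): §6 `section LawFree` adds, under NEW
NAMES and with ED. 1's :1–:423 byte-frozen, the (ℓ8)-FREE and `hunr`-FREE twins of the two (ℓ8)-bound decls — `oneDimNotTheta_of_record₀ (hμu)` (relation `OneDimNotTheta` at the
record from S5-C2 ED. 2a's law-free head `R90.S5.not_isThetaFin_of_isOneDimH₀ (hμu) (h1)`, no `h8 : ∀ v, (𝔩 v).OneDimHLaw` — that pin is UNSATISFIABLE at the record kit, S5 A2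
FINDING 22:29:06Z — and no cofinite-unramifiedness datum `hunr`) and `aPacketMult_of_record_of_isOneDimH₀` (Thm. 13.3.7 for `Π(ξ)` for EVERY one-dimensional `ξ`, `μω` unitary
only) — plus the ED. 2 cert `example` (S5's ★ consumer instantiated with `h1 := oneDimNotTheta_of_record₀ … hμu`, NO `h8`∕`hunr` among its binders) and an OLD → NEW `example`.
ED. 1's `oneDimNotTheta_of_record`∕`aPacketMult_of_record_of_isOneDimH`∕§5 cert stay as typed (sound abstract theorems in `𝔩`; never instantiated at `R90.S4.rogawskiLocalKit`).
HONEST LABEL: a datum and its pin-laws prove nothing toward h413 by themselves; HC_CM is proved only modulo the 7 printed citations (2 remaining named inputs: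
hLiu418 = `stmt-HodgeConjecture-24832`, h413 = `stmt-HodgeConjecture-24833`) until rung 0 closes.  0 stubs, 0 sockets, no `instance`, no `notation`.
[cite: Rogawski1990, §13.5–13.7 pp. 205–213; §13.3 Thms. 13.3.5–13.3.7 pp. 202–203; §13.8 (13.8.3) p. 218; §14.6 p. 242; §11.1 Prop. 11.1.1 (a) p. 161]
-/

set_option autoImplicit false
set_option linter.dupNamespace false

noncomputable section

open NumberField IsDedekindDomain MeasureTheory Filter
open scoped Matrix MatrixGroups

namespace Summit.HodgeConjecture.HodgeConjecture.R90.S10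

open Literature.NumberTheory Literature.NumberTheory.Automorphic Literature.NumberTheory.Automorphic.UnitaryGroup
open Literature.NumberTheory.Rogawski1990 Literature.NumberTheory.GaloisRepresentations
open Summit.HodgeConjecture.HodgeConjecture.Cruxes.H413
open Summit.HodgeConjecture.HodgeConjecture.Cruxes.H413.F0P3LocalPacketKit
open Summit.HodgeConjecture.HodgeConjecture.Cruxes.H413.F0P3GlobalPacket
open Summit.HodgeConjecture.HodgeConjecture.Cruxes.H413.F0P3GlobalPacketDiscrete
open Summit.HodgeConjecture.HodgeConjecture.Cruxes.H413.F0P3ArchPacketKit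
open Summit.HodgeConjecture.HodgeConjecture.Cruxes.H413.F0P3SpectralPacket
open Summit.HodgeConjecture.HodgeConjecture.Cruxes.H413.F0P3InnerFormClassificationV6 (TestG TestH splitForm)
open Summit.HodgeConjecture.HodgeConjecture.Cruxes.H413.K2E1SpectralTermsDiscreteHalf (DiscreteClass)
open Summit.HodgeConjecture.HodgeConjecture.R90.S5

variable {L : Type} [Field L] [NumberField L] [IsCMField L]

/-! ## §0 The e.v.p. currency at level `S` (E1): unramified Hecke algebras, bounded star-fixed packages, restricted pure tensors [§13.6 p. 209] -/

/-- **`𝓗_v`** — the unramified Hecke algebra of `U(Φ₃)(F_v)` at the integral level `K_v = U(Φ₃)(𝒪_v)` (★ `heckeAlgebra`, the algebra E1's `evpAtIntegralLevel` packages act on).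
[cite: Rogawski1990, §13.6 p. 209; §4.5 p. 47] -/
abbrev HeckeAt (L : Type) [Field L] [NumberField L] [IsCMField L] (v : HeightOneSpectrum (𝓞 ↥(maximalRealSubfield L))) : Type :=
  heckeAlgebra ℂ ((cmDatum L 3 (splitForm L 3)).Local v) (cmLocalIntegralLevel L 3 (splitForm L 3) v)

/-- **`Germ` OF RECORD** — e.v.p.'s `t = {t_v}_{v∉S}` (★ `Ch13Sec6.EigenvaluePackage S 𝓗`) that are BOUNDED by `bd` (`‖t_v(x)‖ ≤ bd_v x`: the packages of UNITARY classes, §10.3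
p. 159 «the `z_j` are contained in a compact subset») and STAR-FIXED (`t_v(σ_v x) = conj (t_v x)`: `*`-characters).  The pin-laws `HatBounded`∕`UnrStarAlgebra` are TRUE over this
subtype (★ `unrHatPins_of_restricted`) and false over all packages. [cite: Rogawski1990, §13.6 p. 209; §10.3 p. 159; §13.7 p. 213] -/
abbrev GermSub (S : Set (HeightOneSpectrum (𝓞 ↥(maximalRealSubfield L))))
    (bd : ∀ i : {i : HeightOneSpectrum (𝓞 ↥(maximalRealSubfield L)) // i ∉ S}, HeckeAt L i.1 → ℝ)
    (σ : ∀ i : {i : HeightOneSpectrum (𝓞 ↥(maximalRealSubfield L)) // i ∉ S}, HeckeAt L i.1 → HeckeAt L i.1) : Type :=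
  {t : Ch13Sec6.EigenvaluePackage S (HeckeAt L) // (∀ i x, ‖t i x‖ ≤ bd i x) ∧ ∀ i x, t i (σ i x) = (starRingEnd ℂ) (t i x)}

/-- **`Unr` OF RECORD** — restricted pure tensors `f^S = ⊗_{v∉S} f_v`, `f_v ∈ 𝓗_v`, `f_v = 1` for almost all `v` («`f ∈ ⊗_{v∉S} 𝓗_v` (restricted direct product)»).
[cite: Rogawski1990, §13.6 p. 209] -/
abbrev UnrSub (S : Set (HeightOneSpectrum (𝓞 ↥(maximalRealSubfield L)))) : Type :=
  {f : ∀ i : {i : HeightOneSpectrum (𝓞 ↥(maximalRealSubfield L)) // i ∉ S}, HeckeAt L i.1 // {i | f i ≠ 1}.Finite}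

/-! ## §1 The sections this file does NOT own: ONE parameter structure (HEADS-D.v4 F2; instantiated by the twisted-trace-formula owner, J-F-2) -/

section Sections

variable (𝔩 : ∀ v : HeightOneSpectrum (𝓞 ↥(maximalRealSubfield L)), LocalPacketKit L (splitForm L 3) v) (𝔞 : ArchPacketKit) (𝔞H : ArchPacketKitH 𝔞)
  (μ : Measure (adelicGroupData (↥(maximalRealSubfield L)) L (IsCMField.complexConj L) 3 (splitForm L 3)).automorphicQuotient)
  [(adelicGroupData (↥(maximalRealSubfield L)) L (IsCMField.complexConj L) 3 (splitForm L 3)).IsAutomorphicMeasure μ]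
  (μ₂ : Measure (adelicGroupData (↥(maximalRealSubfield L)) L (IsCMField.complexConj L) 2 (Φ L 2)).automorphicQuotient)
  [(adelicGroupData (↥(maximalRealSubfield L)) L (IsCMField.complexConj L) 2 (Φ L 2)).IsAutomorphicMeasure μ₂]
  (μ₁ : Measure (adelicGroupData (↥(maximalRealSubfield L)) L (IsCMField.complexConj L) 1 (Φ L 1)).automorphicQuotient)
  [(adelicGroupData (↥(maximalRealSubfield L)) L (IsCMField.complexConj L) 1 (Φ L 1)).IsAutomorphicMeasure μ₁]
  (archH : (∀ v : HeightOneSpectrum (𝓞 ↥(maximalRealSubfield L)), IrrClass ((cmDatum L 2 (Φ L 2)).Local v)) →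
    (∀ v : HeightOneSpectrum (𝓞 ↥(maximalRealSubfield L)), ((cmDatum L 1 (Φ L 1)).Local v) →* ℂˣ) → 𝔞H.PktInfH)
  [Nonempty 𝔞.PktInf] (Pk : OneDimAutRepH L → ∀ v : HeightOneSpectrum (𝓞 ↥(maximalRealSubfield L)), CMLocalAPacket L (splitForm L 3) v)
  (S : Set (HeightOneSpectrum (𝓞 ↥(maximalRealSubfield L))))
  (bd : ∀ i : {i : HeightOneSpectrum (𝓞 ↥(maximalRealSubfield L)) // i ∉ S}, HeckeAt L i.1 → ℝ)
  (σ : ∀ i : {i : HeightOneSpectrum (𝓞 ↥(maximalRealSubfield L)) // i ∉ S}, HeckeAt L i.1 → HeckeAt L i.1)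
  (TGt : Type)

/-- **`TwistedSections …` — THE SECTIONS OF THE TWISTED COMPARISON AT LEVEL `S` THAT S10-F DOES NOT OWN**, one field per ★ `TwistedComparisonData` field over the S5 carriers of
record (`DiscreteClass (U(Φ₃)) μ` = `𝔊.Rep`, `PacketHOfRecord …` = `𝔊.PacketH`, `PacketGOfRecord …` = `𝔊.Packet`, `GermSub S bd σ` = `Germ`, `UnrSub S` = `Unr`): the
`S`-test spaces and tensors [§13.6 p. 209], the matchings `φ → f`, `φ → φ^H`, `MatchS` [§4.9–4.12], `Tr π_S(f_S)` [§13.3 p. 203], `Π_ε(G̃)` with cuspidality, germ and twisted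
trace `Tr(π̃_S(φ_S)π̃(ε))` [§13.3 p. 202; §13.5 p. 207], the line-(3) germ `t(I_{ρ̃′})` and traces `Tr(I_{ρ̃′,S}(φ_S)I(ε))`, `Tr ρ_S(φ^H_S)` [Prop. 13.5.1 (3); Prop. 13.6.1 (1′)],
the regular characters `θ` with `t(I_μ)`, `Tr(I_{μ,S}(φ_S)I_μ(ε))`, `ρ(θ_j)` [§13.5 p. 206; §13.10 p. 230], the sign `α(ξ)` [(13.8.8)], `θ_G̃`, `SΘ_G`, `SΘ_H` [§13.5–13.6;
Thm. 10.3.1], the germ coefficient [§13.8 p. 214], the packet germ `t(Π)` [§13.3 p. 201], the `πⁿ`-component predicate [Thm. 13.3.6 (c)], and the ONE proof obligation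
`hRepGerm`: every `t(c)` (★ `germOfDiscreteClass S c`) is `bd`-bounded and `σ`-star-fixed (E1: discrete classes are unitary).  Nothing is asserted about these sections here;
the printed relations among them are the NAMED HYPOTHESES of §4. [cite: Rogawski1990, §13.5–13.7 pp. 205–213; §13.3 pp. 201–203; §13.10 p. 230; §14.6 p. 242] -/
structure TwistedSections where
  /-- `S`-parts of test functions on `G̃` [§13.6 p. 209] -/
  TGtS : Type
  /-- `S`-parts of test functions on `G` [§13.6 p. 209] -/
  TGS : Type
  /-- `S`-parts of test functions on `H` [§13.6 p. 209] -/
  THS : Type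
  /-- `φ = φ_S ⊗ φ^S` [§13.6] -/
  tensGt : TGtS → UnrSub S → TGt
  /-- `f = f_S ⊗ b(φ^S)` [§4.5, §13.6] -/
  tensG : TGS → UnrSub S → TestG L
  /-- `φ^H = φ^H_S ⊗ b_H(φ^S)` [§4.5, §13.6] -/
  tensH : THS → UnrSub S → TestH L
  /-- global matching `φ → f` [§4.10–4.12] -/
  MatchG : TGt → TestG L → Prop
  /-- global matching `φ → φ^H` [§4.11–4.12] -/
  MatchH : TGt → TestH L → Prop
  /-- matching of `S`-parts `(φ_S, f_S, f^H_S, φ^H_S)` [§4.9–4.12; §13.7 p. 212] -/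
  MatchS : TGtS → TGS → THS → THS → Prop
  /-- `Tr π_S(f_S)` for a discrete class `π` of `U(Φ₃)` [§13.3 p. 203] -/
  trS : DiscreteClass (adelicGroupData (↥(maximalRealSubfield L)) L (IsCMField.complexConj L) 3 (splitForm L 3)) μ → TGS → ℂ
  /-- `Π_ε(G̃)` [§13.3 p. 202] -/
  RepGt : Type
  /-- `π̃` is cuspidal [§13.3 p. 202] -/
  IsCuspidalGt : RepGt → Prop
  /-- `t(π̃)` off `S` [§13.6] -/
  germGt : RepGt → GermSub S bd σ
  /-- `Tr(π̃_S(φ_S) π̃(ε))` [§13.5 p. 207] -/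
  trEpsS : RepGt → TGtS → ℂ
  /-- `t(I_{ρ̃′})` off `S`, `ρ̃′ = ψ′_H(ρ)` [§13.5 p. 206; Lemma 13.6.3 p. 211] -/
  germI : PacketHOfRecord 𝔩 𝔞 𝔞H μ₂ μ₁ archH → GermSub S bd σ
  /-- `Tr(I_{ρ̃′,S}(φ_S) I_{ρ̃′}(ε))` [Prop. 13.5.1 (3) p. 208] -/
  trIS : PacketHOfRecord 𝔩 𝔞 𝔞H μ₂ μ₁ archH → TGtS → ℂ
  /-- `Tr ρ_S(φ^H_S)` [Prop. 13.6.1 (1′) p. 209; (13.8.3) p. 218] -/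
  trHS : PacketHOfRecord 𝔩 𝔞 𝔞H μ₂ μ₁ archH → THS → ℂ
  /-- regular `θ` of `C∖𝐂` modulo `G`-conjugacy [§13.5 p. 206; §13.10 p. 230] -/
  ThetaReg : Type
  /-- `t(I_μ)`, `μ = μ′(θ)`, off `S` [§13.10 p. 230] -/
  germTheta : ThetaReg → GermSub S bd σ
  /-- `Tr(I_{μ,S}(φ_S) I_μ(ε))` [Prop. 13.5.1 (4) p. 208] -/
  trIμS : ThetaReg → TGtS → ℂ
  /-- `ρ(θ_j)`, `j = 1, 2, 3` [§13.10 p. 230] -/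
  rhoTheta : ThetaReg → Fin 3 → PacketHOfRecord 𝔩 𝔞 𝔞H μ₂ μ₁ archH
  /-- the A-packet sign `α(ξ) = ±1` [(13.8.8) p. 227; Thm. 13.3.6 (b)] -/
  alpha : PacketHOfRecord 𝔩 𝔞 𝔞H μ₂ μ₁ archH → ℂ
  /-- `θ_G̃(φ)` [§13.5 p. 205; Thm. 10.3.1] -/
  thetaGt : TGt → ℂ
  /-- `SΘ_G(f)` [§13.6 (13.6.1); Thm. 10.3.1 (b)] -/
  SthetaG : TestG L → ℂ
  /-- `SΘ_H(φ^H)` [§13.6 Prop. 13.6.1; §11.2] -/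
  SthetaH : TestH L → ℂ
  /-- the germ coefficient `coeff t (φ_S, f_S, f^H_S, φ^H_S)` [§13.8 p. 214] -/
  coeff : GermSub S bd σ → TGtS → TGS → THS → THS → ℂ
  /-- `t(Π)` off `S` for a packet of record [§13.3 p. 201; §13.6 p. 209] -/
  germPacket : PacketGOfRecord 𝔩 𝔞 μ Pk → GermSub S bd σ
  /-- «`π_v` is of the form `πⁿ(ξ_v)` at some `v ∉ S₀`» for a discrete class of `U(Φ₃)` [Thm. 13.3.6 (c) p. 202] -/
  HasNComponent : DiscreteClass (adelicGroupData (↥(maximalRealSubfield L)) L (IsCMField.complexConj L) 3 (splitForm L 3)) μ → Prop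
  /-- OBLIGATION: `t(c)` is `bd`-bounded and `σ`-star-fixed for every discrete class `c` (E1: unitarity of the discrete spectrum) [§10.3 p. 159; §13.6 p. 209] -/
  hRepGerm : ∀ c : DiscreteClass (adelicGroupData (↥(maximalRealSubfield L)) L (IsCMField.complexConj L) 3 (splitForm L 3)) μ,
    (∀ i x, ‖germOfDiscreteClass S c i x‖ ≤ bd i x) ∧ ∀ i x, germOfDiscreteClass S c i (σ i x) = (starRingEnd ℂ) (germOfDiscreteClass S c i x)

end Sections

/-! ## §2 THE BUILDER: `twistedDatumOfRecord μω pairG 𝔗 : TwistedComparisonData TGt (TestG L) (TestH L)` with `𝔊 := gOfRecord …` [§13.5–13.7] -/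

section Datum

variable {𝔩 : ∀ v : HeightOneSpectrum (𝓞 ↥(maximalRealSubfield L)), LocalPacketKit L (splitForm L 3) v} {𝔞 : ArchPacketKit} {𝔞H : ArchPacketKitH 𝔞}
  {μ : Measure (adelicGroupData (↥(maximalRealSubfield L)) L (IsCMField.complexConj L) 3 (splitForm L 3)).automorphicQuotient}
  [(adelicGroupData (↥(maximalRealSubfield L)) L (IsCMField.complexConj L) 3 (splitForm L 3)).IsAutomorphicMeasure μ]
  {μ₂ : Measure (adelicGroupData (↥(maximalRealSubfield L)) L (IsCMField.complexConj L) 2 (Φ L 2)).automorphicQuotient}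
  [(adelicGroupData (↥(maximalRealSubfield L)) L (IsCMField.complexConj L) 2 (Φ L 2)).IsAutomorphicMeasure μ₂]
  {μ₁ : Measure (adelicGroupData (↥(maximalRealSubfield L)) L (IsCMField.complexConj L) 1 (Φ L 1)).automorphicQuotient}
  [(adelicGroupData (↥(maximalRealSubfield L)) L (IsCMField.complexConj L) 1 (Φ L 1)).IsAutomorphicMeasure μ₁]
  {archH : (∀ v : HeightOneSpectrum (𝓞 ↥(maximalRealSubfield L)), IrrClass ((cmDatum L 2 (Φ L 2)).Local v)) →
    (∀ v : HeightOneSpectrum (𝓞 ↥(maximalRealSubfield L)), ((cmDatum L 1 (Φ L 1)).Local v) →* ℂˣ) → 𝔞H.PktInfH}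
  [Nonempty 𝔞.PktInf] {Pk : OneDimAutRepH L → ∀ v : HeightOneSpectrum (𝓞 ↥(maximalRealSubfield L)), CMLocalAPacket L (splitForm L 3) v}
  (μω : HeckeCharacter L)
  (pairG : Option (PacketHOfRecord 𝔩 𝔞 𝔞H μ₂ μ₁ archH) →
    DiscreteClass (adelicGroupData (↥(maximalRealSubfield L)) L (IsCMField.complexConj L) 3 (splitForm L 3)) μ → ℂ)
  {S : Set (HeightOneSpectrum (𝓞 ↥(maximalRealSubfield L)))}
  {bd : ∀ i : {i : HeightOneSpectrum (𝓞 ↥(maximalRealSubfield L)) // i ∉ S}, HeckeAt L i.1 → ℝ}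
  {σ : ∀ i : {i : HeightOneSpectrum (𝓞 ↥(maximalRealSubfield L)) // i ∉ S}, HeckeAt L i.1 → HeckeAt L i.1}
  {TGt : Type} (𝔗 : TwistedSections 𝔩 𝔞 𝔞H μ μ₂ μ₁ archH Pk S bd σ TGt)

/-- **`twistedDatumOfRecord μω pairG 𝔗` — THE HONEST `𝔨` OF RECORD**: ★ `TwistedComparisonData TGt (TestG L) (TestH L)` with `𝔊 := gOfRecord …` (S5-C2), E1's e.v.p. currency
at level `S` (`Germ := GermSub S bd σ`, `Unr := UnrSub S`, `hat t f := f^∧(t)`, `germRep c := t(c)`), `IsOneDimH := R90.S5.IsOneDimH`, the §14.6 inner-form socket read at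
`U(Φ₃)` itself (`RepGp := DiscreteClass … μ`, `mGp c := c.mult.toNat`, `germGp := germRep`), and every other section from `𝔗`. [cite: Rogawski1990, §13.5–13.7 pp. 205–213; §13.3 pp. 201–203; §14.6 p. 242] -/
def twistedDatumOfRecord : TwistedComparisonData TGt (TestG L) (TestH L) where
  𝔊 := gOfRecord 𝔩 𝔞 𝔞H μ μ₂ μ₁ archH Pk μω pairG
  TGtS := 𝔗.TGtS
  TGS := 𝔗.TGS
  THS := 𝔗.THS
  Unr := UnrSub S
  tensGt := 𝔗.tensGt
  tensG := 𝔗.tensG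
  tensH := 𝔗.tensH
  MatchG := 𝔗.MatchG
  MatchH := 𝔗.MatchH
  MatchS := 𝔗.MatchS
  Germ := GermSub S bd σ
  hat := fun t f => t.1.hat f.1
  germRep := fun c : DiscreteClass (adelicGroupData (↥(maximalRealSubfield L)) L (IsCMField.complexConj L) 3 (splitForm L 3)) μ =>
    ⟨germOfDiscreteClass S c, 𝔗.hRepGerm c⟩
  trS := 𝔗.trS
  RepGt := 𝔗.RepGt
  IsCuspidalGt := 𝔗.IsCuspidalGt
  germGt := 𝔗.germGt
  trEpsS := 𝔗.trEpsS
  germI := 𝔗.germI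
  trIS := 𝔗.trIS
  trHS := 𝔗.trHS
  ThetaReg := 𝔗.ThetaReg
  germTheta := 𝔗.germTheta
  trIμS := 𝔗.trIμS
  rhoTheta := 𝔗.rhoTheta
  IsOneDimH := fun ρ : PacketHOfRecord 𝔩 𝔞 𝔞H μ₂ μ₁ archH => IsOneDimH ρ
  alpha := 𝔗.alpha
  thetaGt := 𝔗.thetaGt
  SthetaG := 𝔗.SthetaG
  SthetaH := 𝔗.SthetaH
  coeff := 𝔗.coeff
  germPacket := 𝔗.germPacket
  RepGp := DiscreteClass (adelicGroupData (↥(maximalRealSubfield L)) L (IsCMField.complexConj L) 3 (splitForm L 3)) μ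
  mGp := fun c => c.mult.toNat
  germGp := fun c => ⟨germOfDiscreteClass S c, 𝔗.hRepGerm c⟩
  HasNComponent := 𝔗.HasNComponent

/-! ### §2.1 Read-backs (`rfl`) — the pins S5's pay edition writes `rfl` for ARE `rfl` -/

/-- `𝔨.𝔊` IS S5-C2's `gOfRecord …` (definitional). [cite: Rogawski1990, §13.3 pp. 201–203] -/
theorem twistedDatumOfRecord_G : (twistedDatumOfRecord μω pairG 𝔗).𝔊 = gOfRecord 𝔩 𝔞 𝔞H μ μ₂ μ₁ archH Pk μω pairG := rfl

/-- `𝔨.Germ` = the bounded star-fixed packages at level `S`. [cite: Rogawski1990, §13.6 p. 209] -/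
theorem twistedDatumOfRecord_Germ : (twistedDatumOfRecord μω pairG 𝔗).Germ = GermSub S bd σ := rfl

/-- `𝔨.Unr` = restricted pure tensors off `S`. [cite: Rogawski1990, §13.6 p. 209] -/
theorem twistedDatumOfRecord_Unr : (twistedDatumOfRecord μω pairG 𝔗).Unr = UnrSub S := rfl

/-- `𝔨.hat t f = f^∧(t) = ∏ᶠ_v t_v(f_v)` (★ `Ch13Sec6.EigenvaluePackage.hat`). [cite: Rogawski1990, §13.6 p. 209] -/
theorem twistedDatumOfRecord_hat (t : GermSub S bd σ) (f : UnrSub S) : (twistedDatumOfRecord μω pairG 𝔗).hat t f = t.1.hat f.1 := rfl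

/-- `𝔨.germRep c = t(c)` (★ `germOfDiscreteClass S c`, value). [cite: Rogawski1990, §13.6 p. 209] -/
theorem twistedDatumOfRecord_germRep_val (c : DiscreteClass (adelicGroupData (↥(maximalRealSubfield L)) L (IsCMField.complexConj L) 3 (splitForm L 3)) μ) :
    ((twistedDatumOfRecord μω pairG 𝔗).germRep c).1 = germOfDiscreteClass S c := rfl

/-- `𝔨.RepGp` = discrete classes of `U(Φ₃)` (the §14.6 socket read at the quasi-split form). [cite: Rogawski1990, §14.6 p. 242] -/
theorem twistedDatumOfRecord_RepGp :
    (twistedDatumOfRecord μω pairG 𝔗).RepGp = DiscreteClass (adelicGroupData (↥(maximalRealSubfield L)) L (IsCMField.complexConj L) 3 (splitForm L 3)) μ := rfl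

/-- `𝔨.mGp c = c.mult.toNat` (= `𝔨.𝔊.m c`; junk `0` at `mult = ⊤`, C5 note). [cite: Rogawski1990, §14.5 p. 238; §13.3 Thm. 13.3.1 p. 201] -/
theorem twistedDatumOfRecord_mGp (c : DiscreteClass (adelicGroupData (↥(maximalRealSubfield L)) L (IsCMField.complexConj L) 3 (splitForm L 3)) μ) :
    (twistedDatumOfRecord μω pairG 𝔗).mGp c = c.mult.toNat := rfl

/-- `𝔨.mGp = 𝔨.𝔊.m` (S5's `hPin_mGp` is `hPin_m`). [cite: Rogawski1990, §13.3 Thm. 13.3.1 p. 201] -/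
theorem twistedDatumOfRecord_mGp_eq_m (c : DiscreteClass (adelicGroupData (↥(maximalRealSubfield L)) L (IsCMField.complexConj L) 3 (splitForm L 3)) μ) :
    (twistedDatumOfRecord μω pairG 𝔗).mGp c = (twistedDatumOfRecord μω pairG 𝔗).𝔊.m c := rfl

/-- **S5's pin `hPin_germGp` at `clsGp := cls` IS `rfl`**: `𝔨.germRep c = 𝔨.germGp c`. [cite: Rogawski1990, §14.6 p. 242 («`t_v` can be regarded as an e.v.p. on either `G′` or `G`»)] -/
theorem twistedDatumOfRecord_germRep_eq_germGp (c : DiscreteClass (adelicGroupData (↥(maximalRealSubfield L)) L (IsCMField.complexConj L) 3 (splitForm L 3)) μ) :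
    (twistedDatumOfRecord μω pairG 𝔗).germRep c = (twistedDatumOfRecord μω pairG 𝔗).germGp c := rfl

/-- `𝔨.IsOneDimH ρ ↔ R90.S5.IsOneDimH ρ` (★ p862138). [cite: Rogawski1990, §13.3 pp. 202–203] -/
theorem twistedDatumOfRecord_isOneDimH_iff (ρ : PacketHOfRecord 𝔩 𝔞 𝔞H μ₂ μ₁ archH) :
    (twistedDatumOfRecord μω pairG 𝔗).IsOneDimH ρ ↔ IsOneDimH ρ := Iff.rfl

/-- `𝔨.𝔊.IsTheta ρ ↔ IsThetaFin … ρ.fin` (C2 `gOfRecord_IsTheta`). [cite: Rogawski1990, §13.3 p. 203] -/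
theorem twistedDatumOfRecord_isTheta_iff (ρ : PacketHOfRecord 𝔩 𝔞 𝔞H μ₂ μ₁ archH) :
    (twistedDatumOfRecord μω pairG 𝔗).𝔊.IsTheta ρ ↔ IsThetaFin 𝔩 μ₂ μ₁ μω ρ.fin := Iff.rfl

/-! ## §3 The PIN-LAWS of `𝔨` PROVED (★ p862102), hence `Separation`; `PacketTrichotomy` and `OneDimNotTheta` at the record (S5-C2) -/

/-- **PIN-LAW `HatInjective` HOLDS**: `t ↦ (f^S ↦ f^{S∧}(t))` is injective on packages (test against the restricted tensors `1 ⊗ … ⊗ x_v ⊗ … ⊗ 1`).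
[cite: Rogawski1990, §13.7 p. 213; §4.5 p. 47] -/
theorem hatInjective_of_record (hσ : ∀ i, σ i 1 = 1) : (twistedDatumOfRecord μω pairG 𝔗).HatInjective :=
  (unrHatPins_of_restricted S (HeckeAt L) bd σ hσ).1

/-- **PIN-LAW `HatBounded` HOLDS**: `‖f^{S∧}(t)‖ ≤ C_f` uniformly in the bounded packages `t`. [cite: Rogawski1990, §10.3 p. 159; §13.7 p. 213] -/
theorem hatBounded_of_record (hσ : ∀ i, σ i 1 = 1) : (twistedDatumOfRecord μω pairG 𝔗).HatBounded :=
  (unrHatPins_of_restricted S (HeckeAt L) bd σ hσ).2.1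

/-- **PIN-LAW `UnrStarAlgebra` HOLDS**: products, `σ`-images and the unit tensor are test vectors on which every star-fixed `t` is multiplicative, conjugate and `1`.
[cite: Rogawski1990, §10.3 p. 159; §4.5 p. 47] -/
theorem unrStarAlgebra_of_record (hσ : ∀ i, σ i 1 = 1) : (twistedDatumOfRecord μω pairG 𝔗).UnrStarAlgebra :=
  ⟨(unrHatPins_of_restricted S (HeckeAt L) bd σ hσ).2.2.1, (unrHatPins_of_restricted S (HeckeAt L) bd σ hσ).2.2.2.1,
    (unrHatPins_of_restricted S (HeckeAt L) bd σ hσ).2.2.2.2⟩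

/-- **LAW `Separation` HOLDS at the record** — «separating by Hecke eigenvalues» [Langlands] from the three pins (★ `separation_of_pins`); this is S5's binder `hS`.
[cite: Rogawski1990, §13.7 p. 213] [cite: Langlands1980, pp. 208–211] -/
theorem separation_of_record (hσ : ∀ i, σ i 1 = 1) : (twistedDatumOfRecord μω pairG 𝔗).Separation :=
  (twistedDatumOfRecord μω pairG 𝔗).separation_of_pins (hatInjective_of_record μω pairG 𝔗 hσ) (hatBounded_of_record μω pairG 𝔗 hσ)
    (unrStarAlgebra_of_record μω pairG 𝔗 hσ)

/-- **★ `PacketTrichotomy` HOLDS at the record** [Thm. 13.3.5 «`Π(G)` is the disjoint union of `Π_s`, `Π_e`, `Π_a`»] — S5-C2 `gOfRecord_packetTrichotomy` (by logic at the bodies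
of record; print's rigidity content lives in `PacketGOfRecord`'s coherence, see C2); this is S5's binder `hTri`. [cite: Rogawski1990, §13.3 Thm. 13.3.5 p. 202] -/
theorem packetTrichotomy_of_record : (twistedDatumOfRecord μω pairG 𝔗).𝔊.PacketTrichotomy :=
  gOfRecord_packetTrichotomy 𝔩 𝔞 𝔞H μ μ₂ μ₁ archH Pk μω pairG

/-- **RELATION `OneDimNotTheta` HOLDS at the record** — a one-dimensional `ξ ∈ Π(H)` is not of the form `ρ(θ)` [Prop. 11.1.1 (a)]: S5-C2 ★ `not_isThetaFin_of_isOneDimH` (the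
realising pair of `ξ`'s packet is unique and its `U(Φ₂)`-string is one-dimensional, never a θ-lift of record, `μω` unitary); this is S5's binder `h1`.
[cite: Rogawski1990, §11.1 Prop. 11.1.1 (a) p. 161; §13.3 p. 203; §11.4 Prop. 11.4.1 (a) p. 166] -/
theorem oneDimNotTheta_of_record (hμu : μω.IsUnitary)
    (h8 : ∀ v : HeightOneSpectrum (𝓞 ↥(maximalRealSubfield L)), (𝔩 v).OneDimHLaw)
    (hunr : ∀ ξ : OneDimAutRepH L, ∀ᶠ v : HeightOneSpectrum (𝓞 ↥(maximalRealSubfield L)) in cofinite, (𝔩 v).unr ((𝔩 v).xiH ((GlobalPacketH.rhoXi h8 ξ).loc v))) :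
    (twistedDatumOfRecord μω pairG 𝔗).𝔊.OneDimNotTheta (twistedDatumOfRecord μω pairG 𝔗).IsOneDimH :=
  fun _ h1 => not_isThetaFin_of_isOneDimH hμu h8 hunr h1

/-! ## §4 THE HEADS AT THE RECORD: Thm. 13.3.7 for `Π(ξ)` and Thm. 13.3.6 (c) e.v.p. routing, with the pins ∕ trichotomy ∕ (T′) DISCHARGED -/

open scoped Classical in
/-- **THM. 13.3.7 FOR THE A-PACKETS `Π(ξ)` AT THE RECORD** — ★ `aPacketMult_of_coreLaws_of_pins` at `𝔨 := twistedDatumOfRecord μω pairG 𝔗` with `HatInjective`, `HatBounded`,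
`UnrStarAlgebra` DISCHARGED (§3): from the six analytic core laws (NAMED hypotheses; payers S10 D∕B∕A, S5), for a one-dimensional `ξ` not of the form `ρ(θ)`, inside the germ
of `t(I_{ξ̃′})`: `2 m(π) = α(ξ)⟨1, π⟩ + 1` on the members of `Π(ξ)` and `m(π) = 0` off it (the `if` is ★'s classical one, `open scoped Classical in` as in ★).
[cite: Rogawski1990, Thm. 13.3.7 p. 203; §13.10 p. 231; §13.8 (13.8.3) p. 218, (13.8.8) p. 227] -/
theorem aPacketMult_of_record (hσ : ∀ i, σ i 1 = 1)
    (h0 : (twistedDatumOfRecord μω pairG 𝔗).MainEquality) (hT : (twistedDatumOfRecord μω pairG 𝔗).MatchTensor)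
    (hE : (twistedDatumOfRecord μω pairG 𝔗).GermExpansion) (hCE : (twistedDatumOfRecord μω pairG 𝔗).CoeffEndoscopic)
    (hAL : (twistedDatumOfRecord μω pairG 𝔗).APacketLift) (hLI : (twistedDatumOfRecord μω pairG 𝔗).LinIndepGerm)
    (ξ : PacketHOfRecord 𝔩 𝔞 𝔞H μ₂ μ₁ archH) (h1 : IsOneDimH ξ) (hnt : ¬ IsThetaFin 𝔩 μ₂ μ₁ μω ξ.fin) :
    ∃ P : (twistedDatumOfRecord μω pairG 𝔗).𝔊.Packet, (twistedDatumOfRecord μω pairG 𝔗).𝔊.IsAPacket P ∧ (twistedDatumOfRecord μω pairG 𝔗).𝔊.liftsTo ξ P ∧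
      (𝔗.alpha ξ = 1 ∨ 𝔗.alpha ξ = -1) ∧
      ∀ π : (twistedDatumOfRecord μω pairG 𝔗).GermClass (𝔗.germI ξ),
        2 * ((twistedDatumOfRecord μω pairG 𝔗).𝔊.m π.1 : ℂ) =
          if (twistedDatumOfRecord μω pairG 𝔗).𝔊.mem π.1 P then 𝔗.alpha ξ * (twistedDatumOfRecord μω pairG 𝔗).𝔊.pair none π.1 + 1 else 0 :=
  aPacketMult_of_coreLaws_of_pins _ h0 hT hE (hatInjective_of_record μω pairG 𝔗 hσ) (hatBounded_of_record μω pairG 𝔗 hσ)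
    (unrStarAlgebra_of_record μω pairG 𝔗 hσ) hCE hAL hLI ξ h1 hnt

open scoped Classical in
/-- **THM. 13.3.7 FOR `Π(ξ)` AT THE RECORD, `hnt` DISCHARGED BY (T′)** (`μω` unitary, (ℓ8), cofinite unramifiedness): the same for EVERY one-dimensional `ξ`.
[cite: Rogawski1990, Thm. 13.3.7 p. 203; §11.1 Prop. 11.1.1 (a) p. 161] -/
theorem aPacketMult_of_record_of_isOneDimH (hσ : ∀ i, σ i 1 = 1) (hμu : μω.IsUnitary)
    (h8 : ∀ v : HeightOneSpectrum (𝓞 ↥(maximalRealSubfield L)), (𝔩 v).OneDimHLaw)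
    (hunr : ∀ ξ : OneDimAutRepH L, ∀ᶠ v : HeightOneSpectrum (𝓞 ↥(maximalRealSubfield L)) in cofinite, (𝔩 v).unr ((𝔩 v).xiH ((GlobalPacketH.rhoXi h8 ξ).loc v)))
    (h0 : (twistedDatumOfRecord μω pairG 𝔗).MainEquality) (hT : (twistedDatumOfRecord μω pairG 𝔗).MatchTensor)
    (hE : (twistedDatumOfRecord μω pairG 𝔗).GermExpansion) (hCE : (twistedDatumOfRecord μω pairG 𝔗).CoeffEndoscopic)
    (hAL : (twistedDatumOfRecord μω pairG 𝔗).APacketLift) (hLI : (twistedDatumOfRecord μω pairG 𝔗).LinIndepGerm)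
    (ξ : PacketHOfRecord 𝔩 𝔞 𝔞H μ₂ μ₁ archH) (h1 : IsOneDimH ξ) :
    ∃ P : (twistedDatumOfRecord μω pairG 𝔗).𝔊.Packet, (twistedDatumOfRecord μω pairG 𝔗).𝔊.IsAPacket P ∧ (twistedDatumOfRecord μω pairG 𝔗).𝔊.liftsTo ξ P ∧
      (𝔗.alpha ξ = 1 ∨ 𝔗.alpha ξ = -1) ∧
      ∀ π : (twistedDatumOfRecord μω pairG 𝔗).GermClass (𝔗.germI ξ),
        2 * ((twistedDatumOfRecord μω pairG 𝔗).𝔊.m π.1 : ℂ) =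
          if (twistedDatumOfRecord μω pairG 𝔗).𝔊.mem π.1 P then 𝔗.alpha ξ * (twistedDatumOfRecord μω pairG 𝔗).𝔊.pair none π.1 + 1 else 0 :=
  aPacketMult_of_record μω pairG 𝔗 hσ h0 hT hE hCE hAL hLI ξ h1 (not_isThetaFin_of_isOneDimH hμu h8 hunr h1)

/-- **THM. 13.3.6 (c) E.V.P. ROUTING AT THE RECORD** — ★ `nComponent_routesToAPacket_of_coreLaws` with `PacketTrichotomy` DISCHARGED (§3): from the four §14.6 routing laws (NAMED
hypotheses; payers S5∕S7), a discrete class `π′` of `U(Φ₃)` with `m(π′) ≠ 0` and a `πⁿ(ξ_v)`-component has the e.v.p. of the A-packet of a one-dimensional `ξ`.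
[cite: Rogawski1990, Thm. 13.3.6 (c) p. 202; §14.6 p. 242; §15.3 ¶1 p. 250] -/
theorem nComponent_routesToAPacket_of_record
    (hPG : (twistedDatumOfRecord μω pairG 𝔗).PacketGerm) (hED : (twistedDatumOfRecord μω pairG 𝔗).EvpDichotomyGp)
    (hSX : (twistedDatumOfRecord μω pairG 𝔗).StableExclusionGp) (hEX : (twistedDatumOfRecord μω pairG 𝔗).EndoscopicExclusionGp)
    (π' : DiscreteClass (adelicGroupData (↥(maximalRealSubfield L)) L (IsCMField.complexConj L) 3 (splitForm L 3)) μ)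
    (hm : (twistedDatumOfRecord μω pairG 𝔗).mGp π' ≠ 0) (hn : 𝔗.HasNComponent π') :
    ∃ (P : (twistedDatumOfRecord μω pairG 𝔗).𝔊.Packet) (ξ : (twistedDatumOfRecord μω pairG 𝔗).𝔊.PacketH),
      (twistedDatumOfRecord μω pairG 𝔗).𝔊.IsAPacket P ∧ (twistedDatumOfRecord μω pairG 𝔗).IsOneDimH ξ ∧ (twistedDatumOfRecord μω pairG 𝔗).𝔊.liftsTo ξ P ∧
      (twistedDatumOfRecord μω pairG 𝔗).germGp π' = 𝔗.germI ξ ∧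
      (∀ π : DiscreteClass (adelicGroupData (↥(maximalRealSubfield L)) L (IsCMField.complexConj L) 3 (splitForm L 3)) μ,
        (twistedDatumOfRecord μω pairG 𝔗).𝔊.mem π P → (twistedDatumOfRecord μω pairG 𝔗).germRep π = (twistedDatumOfRecord μω pairG 𝔗).germGp π') :=
  nComponent_routesToAPacket_of_coreLaws _ (packetTrichotomy_of_record μω pairG 𝔗) hPG hED hSX hEX π' hm hn

/-! ## §5 CERT (an `example`; HEADS-D.v4 F3): S5's ★ consumer `finTriggerMembershipAt_of_coreLaws_of_pins` (13.3.6 (c) finite trigger, twelve named laws + pins) INSTANTIATES at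
`𝔨 := twistedDatumOfRecord μω pairG 𝔗` with `hS`, `hTri`, `h1` DISCHARGED by §3 and the pins S5 D ED. 4 writes — `clsGp := cls`, `hPin_mGp := hPin_m`, `hPin_germGp := rfl` — ARE
accepted as written; the ten remaining law binders and `hPin_n`∕`hPin_memEnv` stay the consumer's named hypotheses. [cite: Rogawski1990, Thm. 13.3.6 (c) p. 202; §13.10 p. 230] -/
example (hσ : ∀ i, σ i 1 = 1) (hμu : μω.IsUnitary)
    (h8 : ∀ v : HeightOneSpectrum (𝓞 ↥(maximalRealSubfield L)), (𝔩 v).OneDimHLaw)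
    (hunr : ∀ ξ : OneDimAutRepH L, ∀ᶠ v : HeightOneSpectrum (𝓞 ↥(maximalRealSubfield L)) in cofinite, (𝔩 v).unr ((𝔩 v).xiH ((GlobalPacketH.rhoXi h8 ξ).loc v)))
    (hH : ((splitForm L 3).map (cmConjRingHom L))ᵀ = splitForm L 3) (hHd : IsUnit (splitForm L 3).det)
    (P : DiscreteAutomorphicRep (adelicGroupData (↥(maximalRealSubfield L)) L (IsCMField.complexConj L) 3 (splitForm L 3)) μ)
    (v : HeightOneSpectrum (𝓞 ↥(maximalRealSubfield L)))
    (T : GL (Fin 3) (LocalRing L v)) (a : LocalRing L v) (ha : IsUnit a)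
    (h : formCongr (conjLocal L (IsCMField.complexConj L) v) T ((splitForm L 3).map (algebraMap L (LocalRing L v))) =
      a • (Matrix.of fun i j : Fin 3 => if i.val + j.val + 1 = 3 then (1 : L) else 0).map (algebraMap L (LocalRing L v)))
    (πn : IrrClass (Gqs L v))
    (h0 : (twistedDatumOfRecord μω pairG 𝔗).MainEquality) (hT : (twistedDatumOfRecord μω pairG 𝔗).MatchTensor)
    (hE : (twistedDatumOfRecord μω pairG 𝔗).GermExpansion) (hCE : (twistedDatumOfRecord μω pairG 𝔗).CoeffEndoscopic)
    (hAL : (twistedDatumOfRecord μω pairG 𝔗).APacketLift) (hLI : (twistedDatumOfRecord μω pairG 𝔗).LinIndepGerm)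
    (hPG : (twistedDatumOfRecord μω pairG 𝔗).PacketGerm) (hED : (twistedDatumOfRecord μω pairG 𝔗).EvpDichotomyGp)
    (hSX : (twistedDatumOfRecord μω pairG 𝔗).StableExclusionGp) (hEX : (twistedDatumOfRecord μω pairG 𝔗).EndoscopicExclusionGp)
    (cls : DiscreteClass (adelicGroupData (↥(maximalRealSubfield L)) L (IsCMField.complexConj L) 3 (splitForm L 3)) μ)
    (hPin_m : (twistedDatumOfRecord μω pairG 𝔗).𝔊.m cls ≠ 0)
    (hPin_n : (∃ c : IrrClass ((cmDatum L 3 (splitForm L 3)).Local v),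
        (IrrClass.comap (localPiEquiv L (IsCMField.complexConj L) 3 (splitForm L 3) v) c).IsConstituentOf
            (P.finRep.smoothPart.toRepresentation.comp (inclPlace (↥(maximalRealSubfield L)) L (IsCMField.complexConj L) 3 (splitForm L 3) v)) ∧
          c = IrrClass.comap (cmDatumLocalCongr L v T ha h).symm πn) → 𝔗.HasNComponent cls)
    (hPin_memEnv : ∀ (Pk : (twistedDatumOfRecord μω pairG 𝔗).𝔊.Packet) (ξH : PacketHOfRecord 𝔩 𝔞 𝔞H μ₂ μ₁ archH),
      (twistedDatumOfRecord μω pairG 𝔗).𝔊.IsAPacket Pk → IsOneDimH ξH → (twistedDatumOfRecord μω pairG 𝔗).𝔊.liftsTo ξH Pk →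
      (twistedDatumOfRecord μω pairG 𝔗).𝔊.mem cls Pk → ∃ ξ' : OneDimAutRepH L, MemXiFamily P hH hHd μω hμu ξ') :
    (∃ c : IrrClass ((cmDatum L 3 (splitForm L 3)).Local v),
        (IrrClass.comap (localPiEquiv L (IsCMField.complexConj L) 3 (splitForm L 3) v) c).IsConstituentOf
            (P.finRep.smoothPart.toRepresentation.comp (inclPlace (↥(maximalRealSubfield L)) L (IsCMField.complexConj L) 3 (splitForm L 3) v)) ∧
          c = IrrClass.comap (cmDatumLocalCongr L v T ha h).symm πn) →
      ∃ ξ' : OneDimAutRepH L, MemXiFamily P hH hHd μω hμu ξ' :=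
  finTriggerMembershipAt_of_coreLaws_of_pins L (splitForm L 3) hH hHd μω hμu μ P v T a ha h πn (twistedDatumOfRecord μω pairG 𝔗)
    h0 hT hE (separation_of_record μω pairG 𝔗 hσ) hCE hAL hLI (packetTrichotomy_of_record μω pairG 𝔗) hPG hED hSX hEX
    (oneDimNotTheta_of_record μω pairG 𝔗 hμu h8 hunr) cls hPin_m cls hPin_m rfl hPin_n hPin_memEnv

end Datum

/-! ## §6 (ED. 2) `section LawFree` — THE (ℓ8)-FREE, `hunr`-FREE TWINS over S5-C2 ED. 2a `not_isThetaFin_of_isOneDimH₀` (ADDITIONS ONLY, new names; ED. 1 untouched) -/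

section LawFree

variable {𝔩 : ∀ v : HeightOneSpectrum (𝓞 ↥(maximalRealSubfield L)), LocalPacketKit L (splitForm L 3) v} {𝔞 : ArchPacketKit} {𝔞H : ArchPacketKitH 𝔞}
  {μ : Measure (adelicGroupData (↥(maximalRealSubfield L)) L (IsCMField.complexConj L) 3 (splitForm L 3)).automorphicQuotient}
  [(adelicGroupData (↥(maximalRealSubfield L)) L (IsCMField.complexConj L) 3 (splitForm L 3)).IsAutomorphicMeasure μ]
  {μ₂ : Measure (adelicGroupData (↥(maximalRealSubfield L)) L (IsCMField.complexConj L) 2 (Φ L 2)).automorphicQuotient}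
  [(adelicGroupData (↥(maximalRealSubfield L)) L (IsCMField.complexConj L) 2 (Φ L 2)).IsAutomorphicMeasure μ₂]
  {μ₁ : Measure (adelicGroupData (↥(maximalRealSubfield L)) L (IsCMField.complexConj L) 1 (Φ L 1)).automorphicQuotient}
  [(adelicGroupData (↥(maximalRealSubfield L)) L (IsCMField.complexConj L) 1 (Φ L 1)).IsAutomorphicMeasure μ₁]
  {archH : (∀ v : HeightOneSpectrum (𝓞 ↥(maximalRealSubfield L)), IrrClass ((cmDatum L 2 (Φ L 2)).Local v)) →
    (∀ v : HeightOneSpectrum (𝓞 ↥(maximalRealSubfield L)), ((cmDatum L 1 (Φ L 1)).Local v) →* ℂˣ) → 𝔞H.PktInfH}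
  [Nonempty 𝔞.PktInf] {Pk : OneDimAutRepH L → ∀ v : HeightOneSpectrum (𝓞 ↥(maximalRealSubfield L)), CMLocalAPacket L (splitForm L 3) v}
  (μω : HeckeCharacter L)
  (pairG : Option (PacketHOfRecord 𝔩 𝔞 𝔞H μ₂ μ₁ archH) →
    DiscreteClass (adelicGroupData (↥(maximalRealSubfield L)) L (IsCMField.complexConj L) 3 (splitForm L 3)) μ → ℂ)
  {S : Set (HeightOneSpectrum (𝓞 ↥(maximalRealSubfield L)))}
  {bd : ∀ i : {i : HeightOneSpectrum (𝓞 ↥(maximalRealSubfield L)) // i ∉ S}, HeckeAt L i.1 → ℝ}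
  {σ : ∀ i : {i : HeightOneSpectrum (𝓞 ↥(maximalRealSubfield L)) // i ∉ S}, HeckeAt L i.1 → HeckeAt L i.1}
  {TGt : Type} (𝔗 : TwistedSections 𝔩 𝔞 𝔞H μ μ₂ μ₁ archH Pk S bd σ TGt)

/-- **RELATION `OneDimNotTheta` HOLDS at the record, (ℓ8)-FREE and `hunr`-FREE (ED. 2)** — a one-dimensional `ξ ∈ Π(H)` is not of the form `ρ(θ)` [Prop. 11.1.1 (a)]:
S5-C2 ED. 2a `not_isThetaFin_of_isOneDimH₀` (the realising pair of a character-packet family is forced; ★ `not_isThetaOfRecord_piTwoOfOneDim`; `μω` unitary) — ED. 1's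
`oneDimNotTheta_of_record hμu h8 hunr` WITHOUT the (ℓ8) pin `h8` (refuted at the record kit, S5 A2) and WITHOUT the unramifiedness datum `hunr`; this is S5's binder `h1`.
[cite: Rogawski1990, §11.1 Prop. 11.1.1 (a) p. 161; §13.3 p. 203; §11.4 Prop. 11.4.1 (a) p. 166] -/
theorem oneDimNotTheta_of_record₀ (hμu : μω.IsUnitary) :
    (twistedDatumOfRecord μω pairG 𝔗).𝔊.OneDimNotTheta (twistedDatumOfRecord μω pairG 𝔗).IsOneDimH :=
  fun _ h1 => not_isThetaFin_of_isOneDimH₀ hμu h1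

open scoped Classical in
/-- **THM. 13.3.7 FOR `Π(ξ)` AT THE RECORD, `hnt` DISCHARGED (ℓ8)-FREE (ED. 2)** (`μω` unitary only): the same conclusion as ED. 1's `aPacketMult_of_record_of_isOneDimH` for EVERY
one-dimensional `ξ`, the binders `h8`, `hunr` GONE (S5-C2 ED. 2a `not_isThetaFin_of_isOneDimH₀`). [cite: Rogawski1990, Thm. 13.3.7 p. 203; §11.1 Prop. 11.1.1 (a) p. 161] -/
theorem aPacketMult_of_record_of_isOneDimH₀ (hσ : ∀ i, σ i 1 = 1) (hμu : μω.IsUnitary)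
    (h0 : (twistedDatumOfRecord μω pairG 𝔗).MainEquality) (hT : (twistedDatumOfRecord μω pairG 𝔗).MatchTensor)
    (hE : (twistedDatumOfRecord μω pairG 𝔗).GermExpansion) (hCE : (twistedDatumOfRecord μω pairG 𝔗).CoeffEndoscopic)
    (hAL : (twistedDatumOfRecord μω pairG 𝔗).APacketLift) (hLI : (twistedDatumOfRecord μω pairG 𝔗).LinIndepGerm)
    (ξ : PacketHOfRecord 𝔩 𝔞 𝔞H μ₂ μ₁ archH) (h1 : IsOneDimH ξ) :
    ∃ P : (twistedDatumOfRecord μω pairG 𝔗).𝔊.Packet, (twistedDatumOfRecord μω pairG 𝔗).𝔊.IsAPacket P ∧ (twistedDatumOfRecord μω pairG 𝔗).𝔊.liftsTo ξ P ∧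
      (𝔗.alpha ξ = 1 ∨ 𝔗.alpha ξ = -1) ∧
      ∀ π : (twistedDatumOfRecord μω pairG 𝔗).GermClass (𝔗.germI ξ),
        2 * ((twistedDatumOfRecord μω pairG 𝔗).𝔊.m π.1 : ℂ) =
          if (twistedDatumOfRecord μω pairG 𝔗).𝔊.mem π.1 P then 𝔗.alpha ξ * (twistedDatumOfRecord μω pairG 𝔗).𝔊.pair none π.1 + 1 else 0 :=
  aPacketMult_of_record μω pairG 𝔗 hσ h0 hT hE hCE hAL hLI ξ h1 (not_isThetaFin_of_isOneDimH₀ hμu h1)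

/-- **CERT (ED. 2, an `example`)**: S5's ★ consumer `finTriggerMembershipAt_of_coreLaws_of_pins` instantiates at `𝔨 := twistedDatumOfRecord μω pairG 𝔗` exactly as in ED. 1 §5,
now with `h1 := oneDimNotTheta_of_record₀ … hμu` — NO `h8`, NO `hunr` among the binders. [cite: Rogawski1990, Thm. 13.3.6 (c) p. 202; §13.10 p. 230] -/
example (hσ : ∀ i, σ i 1 = 1) (hμu : μω.IsUnitary)
    (hH : ((splitForm L 3).map (cmConjRingHom L))ᵀ = splitForm L 3) (hHd : IsUnit (splitForm L 3).det)
    (P : DiscreteAutomorphicRep (adelicGroupData (↥(maximalRealSubfield L)) L (IsCMField.complexConj L) 3 (splitForm L 3)) μ)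
    (v : HeightOneSpectrum (𝓞 ↥(maximalRealSubfield L)))
    (T : GL (Fin 3) (LocalRing L v)) (a : LocalRing L v) (ha : IsUnit a)
    (h : formCongr (conjLocal L (IsCMField.complexConj L) v) T ((splitForm L 3).map (algebraMap L (LocalRing L v))) =
      a • (Matrix.of fun i j : Fin 3 => if i.val + j.val + 1 = 3 then (1 : L) else 0).map (algebraMap L (LocalRing L v)))
    (πn : IrrClass (Gqs L v))
    (h0 : (twistedDatumOfRecord μω pairG 𝔗).MainEquality) (hT : (twistedDatumOfRecord μω pairG 𝔗).MatchTensor)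
    (hE : (twistedDatumOfRecord μω pairG 𝔗).GermExpansion) (hCE : (twistedDatumOfRecord μω pairG 𝔗).CoeffEndoscopic)
    (hAL : (twistedDatumOfRecord μω pairG 𝔗).APacketLift) (hLI : (twistedDatumOfRecord μω pairG 𝔗).LinIndepGerm)
    (hPG : (twistedDatumOfRecord μω pairG 𝔗).PacketGerm) (hED : (twistedDatumOfRecord μω pairG 𝔗).EvpDichotomyGp)
    (hSX : (twistedDatumOfRecord μω pairG 𝔗).StableExclusionGp) (hEX : (twistedDatumOfRecord μω pairG 𝔗).EndoscopicExclusionGp)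
    (cls : DiscreteClass (adelicGroupData (↥(maximalRealSubfield L)) L (IsCMField.complexConj L) 3 (splitForm L 3)) μ)
    (hPin_m : (twistedDatumOfRecord μω pairG 𝔗).𝔊.m cls ≠ 0)
    (hPin_n : (∃ c : IrrClass ((cmDatum L 3 (splitForm L 3)).Local v),
        (IrrClass.comap (localPiEquiv L (IsCMField.complexConj L) 3 (splitForm L 3) v) c).IsConstituentOf
            (P.finRep.smoothPart.toRepresentation.comp (inclPlace (↥(maximalRealSubfield L)) L (IsCMField.complexConj L) 3 (splitForm L 3) v)) ∧
          c = IrrClass.comap (cmDatumLocalCongr L v T ha h).symm πn) → 𝔗.HasNComponent cls)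
    (hPin_memEnv : ∀ (Pk : (twistedDatumOfRecord μω pairG 𝔗).𝔊.Packet) (ξH : PacketHOfRecord 𝔩 𝔞 𝔞H μ₂ μ₁ archH),
      (twistedDatumOfRecord μω pairG 𝔗).𝔊.IsAPacket Pk → IsOneDimH ξH → (twistedDatumOfRecord μω pairG 𝔗).𝔊.liftsTo ξH Pk →
      (twistedDatumOfRecord μω pairG 𝔗).𝔊.mem cls Pk → ∃ ξ' : OneDimAutRepH L, MemXiFamily P hH hHd μω hμu ξ') :
    (∃ c : IrrClass ((cmDatum L 3 (splitForm L 3)).Local v),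
        (IrrClass.comap (localPiEquiv L (IsCMField.complexConj L) 3 (splitForm L 3) v) c).IsConstituentOf
            (P.finRep.smoothPart.toRepresentation.comp (inclPlace (↥(maximalRealSubfield L)) L (IsCMField.complexConj L) 3 (splitForm L 3) v)) ∧
          c = IrrClass.comap (cmDatumLocalCongr L v T ha h).symm πn) →
      ∃ ξ' : OneDimAutRepH L, MemXiFamily P hH hHd μω hμu ξ' :=
  finTriggerMembershipAt_of_coreLaws_of_pins L (splitForm L 3) hH hHd μω hμu μ P v T a ha h πn (twistedDatumOfRecord μω pairG 𝔗)
    h0 hT hE (separation_of_record μω pairG 𝔗 hσ) hCE hAL hLI (packetTrichotomy_of_record μω pairG 𝔗) hPG hED hSX hEX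
    (oneDimNotTheta_of_record₀ μω pairG 𝔗 hμu) cls hPin_m cls hPin_m rfl hPin_n hPin_memEnv

/-- OLD → NEW (`example`): ED. 1's (ℓ8)-bound `oneDimNotTheta_of_record hμu h8 hunr` has the type of `oneDimNotTheta_of_record₀ hμu` (binders `h8`, `hunr` idle). [cite: Rogawski1990, §13.3 p. 203] -/
example (hμu : μω.IsUnitary)
    (_h8 : ∀ v : HeightOneSpectrum (𝓞 ↥(maximalRealSubfield L)), (𝔩 v).OneDimHLaw)
    (_hunr : ∀ ξ : OneDimAutRepH L, ∀ᶠ v : HeightOneSpectrum (𝓞 ↥(maximalRealSubfield L)) in cofinite, (𝔩 v).unr ((𝔩 v).xiH ((GlobalPacketH.rhoXi _h8 ξ).loc v))) :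
    (twistedDatumOfRecord μω pairG 𝔗).𝔊.OneDimNotTheta (twistedDatumOfRecord μω pairG 𝔗).IsOneDimH :=
  oneDimNotTheta_of_record₀ μω pairG 𝔗 hμu

end LawFree

end Summit.HodgeConjecture.HodgeConjecture.R90.S10

end
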